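import Literature.AlgebraicGeometry.HodgeTheory.FermatHodgeConjectureAokiProofs
import HarnessLib

/-!
# The Hodge types of the character eigenlines of a Fermat variety (Ran, Prop. 1.7 (ii); Shioda, (1.7)): the `(p,p)` case

Topic `Literature/AlgebraicGeometry/HodgeTheory`. The named fact
`Ran1980_fermatEigenspace_hodgeType_pp`: on the even-dimensional Fermat variety
`X²ᵖₘ = V₊(Σᵢ₌₀^{2p+1} xᵢᵐ)`, a character eigenline `V(β) ⊂ H²ᵖ(X²ᵖₘ(ℂ); ℂ)` of the diagonal group
`μₘ²ᵖ⁺²` with all `βᵢ ≠ 0` contains a non-zero class of Hodge type `(p, p)` only if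
`|β| := (Σᵢ ⟨βᵢ⟩)/m = p + 1`, i.e. `2 Σᵢ ⟨βᵢ⟩ = m (2p + 2)`. This is — with literally these binders —
the hypothesis `hE4` of the tree's Fermat files (`mem_algebraicClasses_fermat_middle_of_eigenspaces`,
`FermatCharacter.isHodge_of_fermatProjector_ne_zero`, `Aoki1987_primePow_of_eigenspaces`,
`hodgeClasses_algebraic_fermat_of_claims_at`, …; files `FermatHodgeConjectureAssembly`,
`FermatHodgeConjectureAokiProofs`) and the registered stub `stub_eigenspaceHodgeType` (S5b) of the
line `cancel-by-any-claim-lattice` of the crux `HodgeFermatVarieties` (`Summits/HodgeConjecture`).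

## The result in print

Z. Ran, *Cycles on Fermat hypersurfaces*, Compositio Math. 42 (1980) 121–142, §1 Prop. 1.7
(numdam p. 125): "(i) `Hⁿ(X, ℂ)` [primitive part] decomposes under `G = μₘⁿ⁺²/Δ` into
1-dimensional eigenspaces corresponding to the characters `χ = (a₀, …, a_{n+1})`, `0 < aᵢ < m`,
`Σ aᵢ ≡ 0 (m)`; (ii) the eigenspace of `χ` lies in `H^{p,q}`, `p + q = n`, with `q` determined by
`s(χ) = Σ aᵢ` [namely `{p, q} = {s(χ)/m - 1, n + 1 - s(χ)/m}`]; (iii) complex conjugation takes the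
`χ`-eigenspace to the `χ⁻¹`-eigenspace." Equivalently T. Shioda, *The Hodge conjecture for Fermat
varieties*, Math. Ann. 245 (1979) 175–184, §1 (1.7): `V(α) ⊂ H^{p,q}` with `{p, q} = {|α| - 1, n + 1 - |α|}`,
`|α| = (Σ ⟨aᵢ⟩)/m` (and Shioda, Proc. Japan Acad. 55A (1979) §4: "the decomposition
`Hⁿ_prim(Xⁿₘ, ℂ) = ⨁ V(α)` … is compatible with the Hodge decomposition"). The proof in print is
Griffiths' description of the Hodge filtration of a smooth hypersurface by residues of rational forms
`Res (x^a Ω / Fᵏ)` (Griffiths 1969 §8; Voisin II Thm. 6.5), each of which is a `μₘⁿ⁺²`-eigenvector.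
In the middle degree of `X²ᵖₘ` the two possible types `(|β| - 1, 2p + 1 - |β|)` and
`(2p + 1 - |β|, |β| - 1)` are both `(p, p)` iff `|β| = p + 1`; since the Hodge decomposition of a
Hodge model is a DIRECT sum (`HodgeModel.isInternal_hodgePQ`), a non-zero class of `V(β)` of type
`(p, p)` forces `|β| = p + 1` — the statement below (the convention for `χ_β`, `g_a^* ξ = χ_β(a) ξ` with
`g_a : [x] ↦ [a • x]`, only swaps `|β| ↔ 2p + 2 - |β|`, which does not affect it).

## What is proved here, and what is not

* PROVED: the conclusion holds unconditionally for every Hodge character `β ∈ 𝔅²ᵖₘ`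
  (`FermatCharacter.IsHodge.two_mul_normSum_eq`, the case `t = 1` of the definition of `𝔅`), so the
  fact only bites on the NON-Hodge zero-free characters (where it says `V(β) ∩ H^{p,p} = 0`); and the
  consequence the Fermat files use it for — **the support of a rational `(p,p)`-class consists of
  Hodge characters** (`FermatCharacter.isHodge_of_fermatProjector_ne_zero_of_hodgeType`, the tree's
  `isHodge_of_fermatProjector_ne_zero` fed the fact).
* NOT proved: the fact. It needs the Hodge decomposition of `H²ᵖ(X²ᵖₘ)` character by character,
  i.e. Griffiths residues / the Dolbeault cohomology of the Fermat hypersurface (the tree has the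
  residue forms only as the named fact `Voisin2003_hypersurface_residueForm` and no computation of
  their periods or characters); see also the reduction of the surface case to `(2,0)`-eigenforms in
  `FermatEigenspaceHodgeDecomposition`.

## References

* [Ran1980] Z. Ran, Cycles on Fermat hypersurfaces, Compositio Math. 42 (1980) 121–142, §1
  Prop. 1.7 (i)–(iii) (numdam p. 125).
* [Shioda1979HodgeFermat] T. Shioda, The Hodge conjecture for Fermat varieties, Math. Ann. 245
  (1979) 175–184, §1 (1.7).
* [Shioda1979PJA] T. Shioda, The Hodge conjecture and the Tate conjecture for Fermat varieties,
  Proc. Japan Acad. 55A (1979) 111–114, §4.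
* [Griffiths1969] P. Griffiths, On the periods of certain rational integrals I, II, Ann. of Math. 90
  (1969), §8.
* [VoisinHodgeII2003] C. Voisin, Hodge Theory and Complex Algebraic Geometry II, CUP 2003, §6.1 Thm. 6.5.
-/

noncomputable section

open CategoryTheory AlgebraicGeometry Finset

namespace Literature.AlgebraicGeometry.HodgeTheory

open Literature.AlgebraicGeometry.Motives Literature.AlgebraicTopology.SingularHomology

/-! ### The named fact -/

/-- **Hodge types of the Fermat eigenlines, `(p,p)` case** (named fact; Ran 1980 Prop. 1.7 (ii),
Shioda 1979 (1.7)). For `m ≥ 1`, `p > 0`, every Hodge model `A` of the standard Fermat variety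
`X²ᵖₘ = fermatHypersurface (2p) m` and every character `β : Fin (2p+2) → ℤ/m` with all `βᵢ ≠ 0`:
if the eigenspace `V(β) = fermatEigenspace m β (2p) ⊂ H²ᵖ(X²ᵖₘ(ℂ); ℂ)` contains a non-zero class
whose pull-back to `A` is of type `(p, p)`, then `2 Σᵢ ⟨βᵢ⟩ = m (2p + 2)` (`|β| = p + 1`). In print:
"the eigenspace of `χ` lies in `H^{p,q}`" with `{p, q} = {|β| - 1, 2p + 1 - |β|}` (Ran Prop. 1.7
(ii); Shioda (1.7) `V(α) ⊂ H^{p,q}`), which is `(p, p)` iff `|β| = p + 1`, combined with the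
directness of the Hodge decomposition of `A` (`HodgeModel.isInternal_hodgePQ`). Verbatim the
hypothesis `hE4` of `mem_algebraicClasses_fermat_middle_of_eigenspaces` /
`FermatCharacter.isHodge_of_fermatProjector_ne_zero` and the stub `stub_eigenspaceHodgeType` of
crux `HodgeFermatVarieties`. Not proved in the tree (Griffiths residues).
[cite: Ran1980, §1 Prop. 1.7 (ii)] [cite: Shioda1979HodgeFermat, §1 (1.7)]
[cite: Shioda1979PJA, §4] -/
def Ran1980_fermatEigenspace_hodgeType_pp : Prop :=
  ∀ (m : ℕ) [NeZero m] ⦃p : ℕ⦄, 0 < p →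
    ∀ (A : HodgeModel (2 * p) (fermatHypersurface (2 * p) m)) (β : Fin (2 * p + 2) → ZMod m),
      (∀ i, β i ≠ 0) →
      (∃ x ∈ fermatEigenspace m β (2 * p), x ≠ 0 ∧ A.pullback (2 * p) x ∈ A.hodgePQ (2 * p) p p) →
        2 * FermatCharacter.normSum β = m * (2 * p + 2)

/-! ### What holds unconditionally: the conclusion on `𝔅` -/

/-- **On a Hodge character the conclusion of the fact is automatic**: `β ∈ 𝔅ʳₘ` means `β` is
admissible and `2 Σᵢ ⟨t βᵢ⟩ = m r` for every unit `t`; at `t = 1`, `2 Σᵢ ⟨βᵢ⟩ = m r`. So the fact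
`Ran1980_fermatEigenspace_hodgeType_pp` carries information only for the zero-free characters
OUTSIDE `𝔅` (their eigenlines meet `H^{p,p}` trivially). [cite: Shioda1979PJA, §1 (definition of 𝔅ⁿₘ)] -/
theorem FermatCharacter.IsHodge.two_mul_normSum_eq {r m : ℕ} [NeZero m] {β : Fin r → ZMod m}
    (h : FermatCharacter.IsHodge β) : 2 * FermatCharacter.normSum β = m * r := by
  simpa only [Units.val_one, one_mul] using h.2 1

/-- The fact restricted to Hodge characters is a theorem (no hypothesis on eigenlines needed).
[cite: Shioda1979PJA, §1] -/
theorem Ran1980_fermatEigenspace_hodgeType_pp_of_isHodge (m : ℕ) [NeZero m] {p : ℕ}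
    (β : Fin (2 * p + 2) → ZMod m) (hβ : FermatCharacter.IsHodge β) :
    2 * FermatCharacter.normSum β = m * (2 * p + 2) :=
  hβ.two_mul_normSum_eq

/-! ### The consequence used by the Fermat files -/

/-- **Granted the fact, the support of a rational `(p,p)`-class on `X²ᵖₘ` consists of Hodge
characters**: if `c ∈ H²ᵖ(X²ᵖₘ(ℂ); ℂ)` is rational, of type `(p,p)` in a Hodge model `A`, and
`π_α c ≠ 0` for a zero-free `α`, then `α ∈ 𝔅²ᵖₘ` — the tree's
`FermatCharacter.isHodge_of_fermatProjector_ne_zero` with its hypothesis `hE4` supplied by the fact.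
[cite: Ran1980, §1 Prop. 1.7 (ii)–(iii)] [cite: Shioda1979PJA, §1 and §4] -/
theorem FermatCharacter.isHodge_of_fermatProjector_ne_zero_of_hodgeType
    (hE4 : Ran1980_fermatEigenspace_hodgeType_pp) {m : ℕ} [NeZero m] {p : ℕ} (hp : 0 < p)
    {c : complexBetti (fermatHypersurface (2 * p) m) (2 * p)} (hc : IsRationalClass c)
    {A : HodgeModel (2 * p) (fermatHypersurface (2 * p) m)}
    (hA : A.pullback (2 * p) c ∈ A.hodgePQ (2 * p) p p)
    {α : Fin (2 * p + 2) → ZMod m} (hα : ∀ i, α i ≠ 0) (hne : fermatProjector m α (2 * p) c ≠ 0) :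
    FermatCharacter.IsHodge α :=
  FermatCharacter.isHodge_of_fermatProjector_ne_zero hp (hE4 m hp) hc hA hα hne

end Literature.AlgebraicGeometry.HodgeTheory

end
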